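import Summits.AtomisticToContinuum.Crystallization.Theorems.BraggSlacknessRigidityStrictCertificateBragg

/-!
# Crux `StrictCertificate` (stmt-AtomisticToContinuum-13167, route `BraggSlacknessRigidity`):
# necessary conditions on a witness, III — the hcp EXTINCTION RULE made explicit

Support file for the line `registered` (lead c3); nothing here closes the item.  Part II
(`…StrictCertificateBragg`) proved `S_P(k) · 𝓕F(k) = 0` for every dual-lattice vector `k` of a witness
template `P`.  Here the structure factor of the hcp template `P = hcpPeriodicConfiguration a h`
(lattice `ℤu + ℤv + ℤ·2h e₃`, motif `{0, w + h e₃}`, `3w = u + v`) is computed: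
`S_P(k) = 1 + e^{−2πi(⟨k,u⟩+⟨k,v⟩)/3 − 2πi⟨k, h e₃⟩}`, which vanishes iff `3 ∣ ⟨k,u⟩ + ⟨k,v⟩` and
`⟨k, h e₃⟩ ∈ ℤ + ½` (the textbook hcp extinction rule "`h + 2k ∈ 3ℤ` and `l` odd").  Consequently
(`hcp_fourier_eq_zero_of_dual`): **for a witness at an hcp template with integrable `F`, `𝓕F(k) = 0` at
every dual-lattice vector `k` with `3 ∤ ⟨k,u⟩ + ⟨k,v⟩` or `⟨k, h e₃⟩ ∈ ℤ`** — in particular on the whole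
in-plane dual lattice `A₂(a)* × {0}` and on `(1/h)ℤ e₃`; by radiality `𝓕F` then vanishes on the spheres
through these vectors.  Registered sub-goal `hcp_extinction_of_clauses` (clauses verbatim).  All `[folklore]`.
-/

noncomputable section

namespace Summit.AtomisticToContinuum.Crystallization.Theorems.BraggSlacknessRigidityStrictCertificate

open Literature.MathematicalPhysics.StatisticalMechanics
open Summit.AtomisticToContinuum.Crystallization.Theses.BraggSlacknessRigidity
open Summit.AtomisticToContinuum.Crystallization.Theorems.ExactCertificateNegative (IsSplit)
open Summit.AtomisticToContinuum.Crystallization.Theorems.ChargedEnergyGapNegative (E3)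
open MeasureTheory
open scoped BigOperators FourierTransform RealInnerProductSpace

/-! ## The hcp template: periods and motif -/

/-- The three period vectors `u`, `v`, `2h e₃` of the hcp template are periods. [folklore] -/
theorem hcp_periods_mem {a h : ℝ} (ha : a ≠ 0) (hh : h ≠ 0) :
    triangularVec₁ a ∈ (hcpPeriodicConfiguration ha hh).lattice ∧
      triangularVec₂ a ∈ (hcpPeriodicConfiguration ha hh).lattice ∧
      (2 : ℝ) • layerNormal h ∈ (hcpPeriodicConfiguration ha hh).lattice := by
  have hW : (haggWindow alternatingHagg 0 2 : ℝ) = 0 := by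
    norm_num [haggWindow, alternatingHagg, Finset.sum_range_succ]
  have h1 := sum_smul_mem_barlowPeriodLattice alternatingHagg ha hh two_ne_zero 1 0 0
  have h2 := sum_smul_mem_barlowPeriodLattice alternatingHagg ha hh two_ne_zero 0 1 0
  have h3 := sum_smul_mem_barlowPeriodLattice alternatingHagg ha hh two_ne_zero 0 0 1
  simp only [Int.cast_one, Int.cast_zero, one_smul, zero_smul, add_zero, zero_add, hW,
    Nat.cast_ofNat] at h1 h2 h3
  exact ⟨h1, h2, h3⟩

/-- The motif of the hcp template is `{0, w + h e₃}` (layers `0` and `1` at `i = j = 0`). [folklore] -/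
theorem hcp_motif_eq {a h : ℝ} (ha : a ≠ 0) (hh : h ≠ 0) :
    (hcpPeriodicConfiguration ha hh).motif =
      (Finset.range 2).image fun m : ℕ => barlowPos a h alternatingHagg m 0 0 := rfl

/-- `barlowPos 0 0 0 = 0` and `barlowPos 1 0 0 = w + h e₃` for the alternating sequence. [folklore] -/
theorem hcp_barlowPos_zero_one (a h : ℝ) :
    barlowPos a h alternatingHagg 0 0 0 = 0 ∧
      barlowPos a h alternatingHagg 1 0 0 = barlowOffset a + layerNormal h := by
  have hL1 : haggLabel alternatingHagg 1 = 1 := by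
    rw [haggLabel_alternating]; decide
  constructor
  · simp [barlowPos]
  · simp [barlowPos, hL1]

/-! ## The structure factor of hcp and the extinction rule -/

/-- **The hcp structure factor.** For every `k`,
`Σ_{x ∈ motif} e^{−2πi⟨x,k⟩} = 1 + e^{−2πi(⟨w,k⟩ + ⟨h e₃,k⟩)}`. [folklore] -/
theorem hcp_structureFactor_eq {a h : ℝ} (ha : a ≠ 0) (hh : h ≠ 0) (k : E3) :
    ∑ x ∈ (hcpPeriodicConfiguration ha hh).motif, Complex.exp (↑(-2 * Real.pi * ⟪x, k⟫) * Complex.I) =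
      1 + Complex.exp (↑(-2 * Real.pi * (⟪barlowOffset a, k⟫ + ⟪layerNormal h, k⟫)) * Complex.I) := by
  obtain ⟨h0, h1⟩ := hcp_barlowPos_zero_one a h
  have hinj : Set.InjOn (fun m : ℕ => barlowPos a h alternatingHagg m 0 0) ↑(Finset.range 2) := by
    intro m hm m' hm' hmm
    have e2 := congrArg (fun x : E3 => x 2) hmm
    simp only [barlowPos_apply_two, Int.cast_natCast] at e2
    exact_mod_cast mul_right_cancel₀ hh e2
  rw [hcp_motif_eq, Finset.sum_image hinj, Finset.sum_range_succ, Finset.sum_range_succ,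
    Finset.sum_range_zero, zero_add]
  simp only [Nat.cast_zero, Nat.cast_one, h0, h1, inner_zero_left, mul_zero, Complex.ofReal_zero,
    zero_mul, Complex.exp_zero, inner_add_left]

/-- **`1 + e^{−2πiθ} = 0` forces `θ ∈ ℤ + ½`.** [folklore] -/
theorem exists_int_of_one_add_exp_eq_zero {θ : ℝ}
    (h0 : 1 + Complex.exp (↑(-2 * Real.pi * θ) * Complex.I) = 0) : ∃ M : ℤ, θ = M + 1 / 2 := by
  have h1 : Complex.exp (↑(-2 * Real.pi * θ) * Complex.I - Real.pi * Complex.I) = 1 := by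
    rw [Complex.exp_sub, Complex.exp_pi_mul_I]
    have : Complex.exp (↑(-2 * Real.pi * θ) * Complex.I) = -1 := by linear_combination h0
    rw [this]
    norm_num
  obtain ⟨n, hn⟩ := Complex.exp_eq_one_iff.1 h1
  have h2 : ((-2 * Real.pi * θ - Real.pi : ℝ) : ℂ) * Complex.I = ((n * (2 * Real.pi) : ℝ) : ℂ) * Complex.I := by
    push_cast at hn ⊢
    linear_combination hn
  have h3 : (-2 * Real.pi * θ - Real.pi : ℝ) = n * (2 * Real.pi) := by
    have := mul_right_cancel₀ Complex.I_ne_zero h2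
    exact_mod_cast this
  refine ⟨-n - 1, ?_⟩
  have hπ : Real.pi ≠ 0 := Real.pi_ne_zero
  have h4 : θ = -n - 1 / 2 := by
    have : Real.pi * (-2 * θ - 1) = Real.pi * (2 * n) := by linear_combination h3
    have := mul_left_cancel₀ hπ this
    linarith
  rw [h4]
  push_cast
  ring

/-- **THE hcp EXTINCTION RULE (necessary condition on a witness).**  For a witness at the hcp template
with integrable `F` and a dual-lattice vector `k` that is NOT extinct — `3 ∤ ⟨k,u⟩ + ⟨k,v⟩`, or
`⟨k, h e₃⟩ ∈ ℤ` — the Fourier transform of the Bochner kernel vanishes: `𝓕F(k) = 0`.  Proof: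
`S_P(k)·𝓕F(k) = 0` (`structureFactor_mul_fourier_eq_zero`) and `S_P(k) = 1 + e^{−2πiθ}`,
`θ = (⟨k,u⟩+⟨k,v⟩)/3 + ⟨k,2h e₃⟩/2` with `⟨k,u⟩, ⟨k,v⟩, ⟨k,2h e₃⟩ ∈ ℤ`, is non-zero unless
`3 ∣ ⟨k,u⟩+⟨k,v⟩` and `⟨k,2h e₃⟩` is odd (parity bookkeeping). [folklore] -/
theorem hcp_fourier_eq_zero_of_dual {a h : ℝ} (ha : a ≠ 0) (hh : h ≠ 0) {ρ c : ℝ} {g U f : ℝ → ℝ}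
    (hs : IsSplit ρ c g U f)
    (hv : c + f 0 / 2 ≤ -((hcpPeriodicConfiguration ha hh).energyPerParticle lennardJones))
    (hFi : Integrable fun v : E3 => (f ‖v‖ : ℂ)) {k : E3}
    (hk : ∀ g ∈ (hcpPeriodicConfiguration ha hh).lattice, ∃ n : ℤ, ⟪k, g⟫ = (n : ℝ))
    (hne : (∀ m : ℤ, ⟪k, triangularVec₁ a⟫ + ⟪k, triangularVec₂ a⟫ ≠ 3 * m) ∨
      (∃ m : ℤ, ⟪k, layerNormal h⟫ = (m : ℝ))) :
    𝓕 (fun v : E3 => (f ‖v‖ : ℂ)) k = 0 := by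
  have hmain := structureFactor_mul_fourier_eq_zero hs hv hFi hk
  rw [hcp_structureFactor_eq ha hh k] at hmain
  rcases mul_eq_zero.1 hmain with hS | hF
  · -- the structure factor does not vanish at a non-extinct `k`: contradiction
    exfalso
    obtain ⟨hu, hv', ht⟩ := hcp_periods_mem ha hh
    obtain ⟨n₁, hn₁⟩ := hk _ hu
    obtain ⟨n₂, hn₂⟩ := hk _ hv'
    obtain ⟨n₃, hn₃⟩ := hk _ ht
    have h3 : (3 : ℝ) * ⟪k, barlowOffset a⟫ = ⟪k, triangularVec₁ a⟫ + ⟪k, triangularVec₂ a⟫ := by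
      rw [← inner_add_right, ← three_smul_barlowOffset, real_inner_smul_right]
    have hw : ⟪barlowOffset a, k⟫ = ((n₁ : ℝ) + n₂) / 3 := by
      rw [real_inner_comm k (barlowOffset a)]
      rw [hn₁, hn₂] at h3
      linarith
    have hl : ⟪layerNormal h, k⟫ = (n₃ : ℝ) / 2 := by
      rw [real_inner_comm k (layerNormal h)]
      rw [real_inner_smul_right] at hn₃
      linarith
    rw [hw, hl] at hS
    obtain ⟨M, hM⟩ := exists_int_of_one_add_exp_eq_zero hS
    -- `(n₁ + n₂)/3 + n₃/2 = M + 1/2`, i.e. `2 (n₁ + n₂) = 3 (2M + 1 − n₃)`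
    have hkey : (2 * (n₁ + n₂) : ℤ) = 3 * (2 * M + 1 - n₃) := by
      have : (2 * (n₁ + n₂) : ℝ) = 3 * (2 * M + 1 - n₃) := by linarith
      exact_mod_cast this
    rcases hne with hne | ⟨m, hm⟩
    · -- `3 ∣ 2(n₁+n₂)` forces `3 ∣ n₁ + n₂`
      have hq : ∃ q : ℤ, n₁ + n₂ = 3 * q := ⟨(n₁ + n₂) - (2 * M + 1 - n₃), by omega⟩
      obtain ⟨q, hq⟩ := hq
      refine hne q ?_
      rw [hn₁, hn₂]
      exact_mod_cast hq
    · -- `⟨k, h e₃⟩ = m ∈ ℤ` forces `n₃ = 2m`, and then `2(n₁+n₂) = 3(2M + 1 − 2m)` is even = odd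
      rw [← real_inner_comm k (layerNormal h)] at hm
      have hn3 : (n₃ : ℝ) = 2 * m := by linarith
      have hn3' : n₃ = 2 * m := by exact_mod_cast hn3
      rw [hn3'] at hkey
      omega
  · exact hF

/-- **Registered sub-goal `hcp_extinction_of_clauses`** (crux conjuncts 2–7 and 11 verbatim as hypotheses,
template `hcpPeriodicConfiguration ha hh`): the hcp extinction rule for every witness of `StrictCertificate`.
[folklore] -/
theorem hcp_extinction_of_clauses : ∀ (a h : ℝ) (ha : a ≠ 0) (hh : h ≠ 0) (ρ c : ℝ) (g U f : ℝ → ℝ), (∀ r : ℝ, 0 < r → Literature.MathematicalPhysics.StatisticalMechanics.lennardJones r = g r + U r + f r) → (∀ r : ℝ, 0 < r → 0 ≤ U r) → (∀ r : ℝ, ρ ≤ r → g r = 0) → (∀ (n : ℕ) (y : Fin n → EuclideanSpace ℝ (Fin 3)) (w : Fin n → ℝ), 0 ≤ ∑ i, ∑ j, w i * w j * f (dist (y i) (y j))) → (∀ (N : ℕ) (x : Fin N → EuclideanSpace ℝ (Fin 3)), Function.Injective x → -(c * (N : ℝ)) ≤ Literature.MathematicalPhysics.StatisticalMechanics.interactionEnergy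 g x) → c + f 0 / 2 = -((Literature.MathematicalPhysics.StatisticalMechanics.hcpPeriodicConfiguration ha hh).energyPerParticle Literature.MathematicalPhysics.StatisticalMechanics.lennardJones) → MeasureTheory.Integrable (fun v : EuclideanSpace ℝ (Fin 3) => (f ‖v‖ : ℂ)) → ∀ k : EuclideanSpace ℝ (Fin 3), (∀ g ∈ (Literature.MathematicalPhysics.StatisticalMechanics.hcpPeriodicConfiguration ha hh).lattice, ∃ n : ℤ, inner ℝ k g = (n : ℝ)) → ((∀ m : ℤ, inner ℝ k (Literature.MathematicalPhysics.StatisticalMechanics.triangularVec₁ a) + inner ℝ k (Literature.MathematicalPhysics.StatisticalMechanics.triangularVec₂ a) ≠ 3 * m) ∨ (∃ m : ℤ, inner ℝ k (Literature.MathematicalPhysics.StatisticalMechanics.layerNormal h) = (m : ℝ))) → FourierTransform.fourier (fun v : EuclideanSpace ℝ (Fin 3) => (f ‖v‖ : ℂ)) k = 0 :=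
  fun _a _h ha hh _ρ _c _g _U _f h1 h2 h3 h4 h5 h6 hFi _k hk hne =>
    hcp_fourier_eq_zero_of_dual ha hh ⟨h1, h2, h3, h4, h5⟩ h6.le hFi hk hne

end Summit.AtomisticToContinuum.Crystallization.Theorems.BraggSlacknessRigidityStrictCertificate

end
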